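import Summits.NavierStokesRegularity.NavierStokesRegularity.Theorems.EulerZoomLiouvillePowerGaugeEulerLiouvillePowerClockRigidityNeg
import Summits.NavierStokesRegularity.NavierStokesRegularity.Theorems.EulerZoomLiouvillePowerGaugeEulerLiouvillePowerClockRigiditySlow
import Summits.NavierStokesRegularity.NavierStokesRegularity.Theorems.EulerZoomLiouvillePowerGaugeEulerLiouvillePowerClockRigidityZero
import Summits.NavierStokesRegularity.NavierStokesRegularity.Theorems.EulerZoomLiouvillePowerGaugeEulerLiouvillePastFastClock
import Summits.NavierStokesRegularity.NavierStokesRegularity.Theorems.EulerZoomLiouvillePowerGaugeEulerLiouvillePastSteady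
import Summits.NavierStokesRegularity.NavierStokesRegularity.Theorems.EulerZoomLiouvillePowerGaugeEulerLiouvilleBreatherRigidity
import Summits.NavierStokesRegularity.NavierStokesRegularity.Theorems.EulerZoomLiouvillePowerGaugeEulerLiouvilleClockRigidity

/-!
# Crux `EulerZoomLiouville.PowerGaugeEulerLiouville` (stmt-NavierStokesRegularity-19832), line `logtime-breathers`:
# CLASSICAL SHAPE-PRESERVING MEMBERS ARE TRIVIAL UNLESS THEY ARE SLOW-WINDOW POWER CLOCKS

Width seat `ns-ezl-w4` (power-clock rigidity, file X — the assembly).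

* `ae_eq_zero_of_gauge_of_classicalPowerClock_offWindow` — classical power clocks about `T₀ ≥ 0` with `γ < 2/5 ∨ γ > 1/(2+ρ)` are trivial
  (`…classicalNegPowerClock` `γ < 0`, `…classicalZeroRatePowerClock` `γ = 0`, `…classicalSlowPowerClock` `0 < γ < 2/5`,
  `…classicalPowerClock` `1/(2+ρ) < γ ≤ 2/3`, `PastShape.ae_eq_zero_of_gauge_of_pastFastPowerClock` `γ > ½ − ρ/5`);
* `ae_eq_zero_of_gauge_of_classicalShapePreserving` — **a CLASSICAL SHAPE-PRESERVING member `u(τ, y) = θ(τ) V(y/ℓ(τ))` of the class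
  (`0 < ρ ≤ ½`) is trivial unless it is a power clock about some `T₀ ≥ 0` with rate in the SLOW WINDOW `2/5 ≤ γ ≤ 1/(2+ρ)`**:
  clock rigidity (g0, `ClockRigidity.clockRigidity_of_classical_shapePreserving`: breather ∨ power clock ∨ steady) + breather rigidity
  (`BreatherRigidity.ae_eq_zero_of_gauge_of_classicalBreather`) + the off-window power clocks + steady past (`PastSteady.ae_eq_zero_of_gauge_of_pastSteady`).

WHAT THIS IS NOT: not NS regularity, not the crux — the classical shape-preserving stratum of the crux CLASS 19832 on the MODEL lattice reduced
to the slow window; `--supports` stmt-19832. [folklore]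
-/

noncomputable section

set_option linter.dupNamespace false

open MeasureTheory Set Filter Topology Metric Function TopologicalSpace
open scoped ENNReal NNReal RealInnerProductSpace ContDiff

namespace Summit.NavierStokesRegularity.NavierStokesRegularity.Theorems.PowerGaugeEulerLiouville

open Literature.Analysis Literature.Analysis.FunctionSpaces Literature.Analysis.FluidPDE

namespace PowerClockRigidity

variable {u : ℝ → EuclideanSpace ℝ (Fin 3) → EuclideanSpace ℝ (Fin 3)} {p : ℝ → EuclideanSpace ℝ (Fin 3) → ℝ}
  {H : ℝ → EuclideanSpace ℝ (Fin 3) → EuclideanSpace ℝ (Fin 3) →L[ℝ] EuclideanSpace ℝ (Fin 3)}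

/-- **CLASSICAL POWER CLOCKS OFF THE SLOW WINDOW ARE TRIVIAL.**  Crux hypotheses (suitable weak pair, weak spatial gradient, the three
power gauges, `0 < ρ ≤ ½`) + `(u, p)` classical Euler on `(−∞, 0) × ℝ³` + `u(τ, y) = (T₀−τ)^{γ−1} W((T₀−τ)^{−γ} y)` for all `τ < 0`
with `T₀ ≥ 0` and `γ < 2/5 ∨ γ > 1/(2+ρ)` ⇒ `u = 0` a.e. on `(−∞,0) × ℝ³`.  (The suitable-weak hypothesis is used only on the fast branch
`γ > 2/3`.) [folklore] -/
theorem ae_eq_zero_of_gauge_of_classicalPowerClock_offWindow {ρ : ℝ} (hρ : 0 < ρ) (hρh : ρ ≤ 1 / 2) {c₀ : ℝ≥0}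
    (hsw : IsSuitableWeakSolutionOn (slab (EuclideanSpace ℝ (Fin 3)) (Iio 0) isOpen_Iio) 0 0 u p)
    (hH : HasWeakSpatialGradientOn (slab (EuclideanSpace ℝ (Fin 3)) (Iio 0) isOpen_Iio) u H)
    (hgauge : ∀ a : ℝ, 0 < a →
      ENNReal.ofReal (a ^ (2 * ρ)) * cknA a (0 : ℝ × EuclideanSpace ℝ (Fin 3)) u +
          ENNReal.ofReal (a ^ ρ) * cknE a (0 : ℝ × EuclideanSpace ℝ (Fin 3)) H +
        ENNReal.ofReal (a ^ (2 * ρ)) * cknD a (0 : ℝ × EuclideanSpace ℝ (Fin 3)) p ≤ (c₀ : ℝ≥0∞))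
    (hcl : IsClassicalEulerSolutionOn (Iio 0) 0 u p) {T₀ g : ℝ} {W : EuclideanSpace ℝ (Fin 3) → EuclideanSpace ℝ (Fin 3)}
    (hT₀ : 0 ≤ T₀) (hg : g < 2 / 5 ∨ 1 / (2 + ρ) < g)
    (hW : ∀ τ : ℝ, τ < 0 → ∀ y, u τ y = (T₀ - τ) ^ (g - 1) • W ((T₀ - τ) ^ (-g) • y)) :
    uncurry u =ᵐ[volume.restrict (Iio (0 : ℝ) ×ˢ (univ : Set (EuclideanSpace ℝ (Fin 3))))] 0 := by
  rcases hg with hlt | hgt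
  · rcases lt_trichotomy g 0 with hneg | hzero | hpos
    · exact ae_eq_zero_of_gauge_of_classicalNegPowerClock hρ hρh hH hgauge hcl hT₀ hneg hW
    · exact ae_eq_zero_of_gauge_of_classicalZeroRatePowerClock hρ hρh hH hgauge hcl hT₀ hzero hW
    · exact ae_eq_zero_of_gauge_of_classicalSlowPowerClock hρ hρh hH hgauge hcl hT₀ hpos hlt hW
  · by_cases h23 : g ≤ 2 / 3
    · exact ae_eq_zero_of_gauge_of_classicalPowerClock hρ hρh hH hgauge hcl hT₀ hgt h23 hW
    · have hfast : 1 / 2 - ρ / 5 < g := by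
        have h23' := not_le.1 h23
        linarith
      exact PastShape.ae_eq_zero_of_gauge_of_pastFastPowerClock hρ hρh hsw hH hgauge le_rfl hT₀ hfast hW

/-- **CLASSICAL SHAPE-PRESERVING MEMBERS ARE TRIVIAL UNLESS THEY ARE SLOW-WINDOW POWER CLOCKS.**  Crux hypotheses (`0 < ρ ≤ ½`) +
`(u, p)` classical Euler on `(−∞,0) × ℝ³` + shape preservation `u(τ, y) = θ(τ) V(ℓ(τ)⁻¹ y)` (positive clocks differentiable on `(−∞,0)`)
+ «`u` is NOT a power clock about some `T₀ ≥ 0` with rate `2/5 ≤ γ ≤ 1/(2+ρ)`» ⇒ `u = 0` a.e. on `(−∞,0) × ℝ³`. [folklore] -/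
theorem ae_eq_zero_of_gauge_of_classicalShapePreserving {ρ : ℝ} (hρ : 0 < ρ) (hρh : ρ ≤ 1 / 2) {c₀ : ℝ≥0}
    (hsw : IsSuitableWeakSolutionOn (slab (EuclideanSpace ℝ (Fin 3)) (Iio 0) isOpen_Iio) 0 0 u p)
    (hH : HasWeakSpatialGradientOn (slab (EuclideanSpace ℝ (Fin 3)) (Iio 0) isOpen_Iio) u H)
    (hgauge : ∀ a : ℝ, 0 < a →
      ENNReal.ofReal (a ^ (2 * ρ)) * cknA a (0 : ℝ × EuclideanSpace ℝ (Fin 3)) u +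
          ENNReal.ofReal (a ^ ρ) * cknE a (0 : ℝ × EuclideanSpace ℝ (Fin 3)) H +
        ENNReal.ofReal (a ^ (2 * ρ)) * cknD a (0 : ℝ × EuclideanSpace ℝ (Fin 3)) p ≤ (c₀ : ℝ≥0∞))
    (hcl : IsClassicalEulerSolutionOn (Iio 0) 0 u p)
    (hshape : ∃ (θ ℓ : ℝ → ℝ) (V : EuclideanSpace ℝ (Fin 3) → EuclideanSpace ℝ (Fin 3)),
      (∀ τ : ℝ, τ < 0 → 0 < θ τ ∧ 0 < ℓ τ) ∧ DifferentiableOn ℝ θ (Iio 0) ∧ DifferentiableOn ℝ ℓ (Iio 0) ∧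
        ∀ τ : ℝ, τ < 0 → ∀ y : EuclideanSpace ℝ (Fin 3), u τ y = θ τ • V ((ℓ τ)⁻¹ • y))
    (hnoslow : ¬ ∃ (T₀ g : ℝ) (W : EuclideanSpace ℝ (Fin 3) → EuclideanSpace ℝ (Fin 3)), 0 ≤ T₀ ∧ 2 / 5 ≤ g ∧ g ≤ 1 / (2 + ρ) ∧
      ∀ τ : ℝ, τ < 0 → ∀ y : EuclideanSpace ℝ (Fin 3), u τ y = (T₀ - τ) ^ (g - 1) • W ((T₀ - τ) ^ (-g) • y)) :
    uncurry u =ᵐ[volume.restrict (Iio (0 : ℝ) ×ˢ (univ : Set (EuclideanSpace ℝ (Fin 3))))] 0 := by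
  rcases ClockRigidity.clockRigidity_of_classical_shapePreserving hρ hρh hH hgauge hcl hshape with
    ⟨c', V, hc', hbr⟩ | ⟨T₀, g, W, hT₀, hW⟩ | ⟨v, hv⟩
  · exact BreatherRigidity.ae_eq_zero_of_gauge_of_classicalBreather hρ hρh hH hgauge hcl hc' hbr
  · have hg : g < 2 / 5 ∨ 1 / (2 + ρ) < g := by
      rcases lt_or_ge g (2 / 5) with h | h
      · exact Or.inl h
      · refine Or.inr (lt_of_not_ge fun h' => hnoslow ⟨T₀, g, W, hT₀, h, h', hW⟩)
    exact ae_eq_zero_of_gauge_of_classicalPowerClock_offWindow hρ hρh hsw hH hgauge hcl hT₀ hg hW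
  · exact PastSteady.ae_eq_zero_of_gauge_of_pastSteady hρ hsw hH hgauge (T₁ := 0) le_rfl (v := v) hv

end PowerClockRigidity

end Summit.NavierStokesRegularity.NavierStokesRegularity.Theorems.PowerGaugeEulerLiouville

end
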